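import Summits.ResolutionOfSingularities.ResolutionOfSingularities.Theorems.PurelyInseparableDim4StepKitTranslate
import Summits.ResolutionOfSingularities.ResolutionOfSingularities.Theorems.PurelyInseparableDim4Scope
import HarnessLib

/-!
# Purely inseparable fourfolds — STEP KIT (3/3), state layer: presented states, the step, and Boolean
# checks for the cell's predicates (cell `res-dim4-pi`, WAVE3 row W3-2 «cert-1»)

[OURS · counted 0 · instrument] Nothing here is a statement about resolution of singularities.

Continues `PurelyInseparableDim4StepKit` / `…StepKitTranslate` (term lists `evalT`, `chartL`, `transAll`, `cleanL`, …).
A PRESENTED STATE `s : SData n K` (term list, exceptional multiplicities `r : Fin n → ℕ`, components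
`exc`) is read as the tree's `CentreBlowup.CState (Fin n) K` by `SData.toState`; `stepD` re-implements
`CentreBlowup.step` on presented states and `step_toState` proves
`CentreBlowup.step q S j b s.toState = (stepD q S j b s).toState` EXACTLY.  For the class-(4,1) frame
(`PIDim4.State K = CState (Fin 4) K`) the predicates `IsPermissibleCentre`, `IsMode1hCentre`, `Perm2`,
`IsEquimultiplePoint`, `step … = …`, `(step …).F ≠ 0`, `RiseD` at presented states are turned into
`Bool`-valued checks (`permB`, `mode1hB`, `perm2B`, `equiB`, `SData.equivB`, …) with `↔` theorems, so a
certificate of an `Edge` / `Step1h` / `StepHP` / trap edge is `edge_of … (by decide) (by decide) (by decide)`.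
No instances are declared; nothing is asserted about resolution; counted 0.
bears_on: LADDER-RESOLUTION:D157-DOOR2 (res-dim4-pi · W3-2). Supports stmt-ResolutionOfSingularities-16155 (helper).
-/

set_option linter.dupNamespace false -- mandated namespace of this single-conjunct summit

noncomputable section

open MvPolynomial Finset

open scoped BigOperators

namespace Summit.ResolutionOfSingularities.ResolutionOfSingularities.Theorems.PIDim4

namespace StepKit

open Literature.AlgebraicGeometry.Resolution
open Literature.AlgebraicGeometry.Resolution.CentreBlowup
open Literature.AlgebraicGeometry.Resolution.Hauser2010

variable {n : ℕ} {R : Type*} [CommRing R]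

/-! ## §7 Presented states and the step -/

/-- A **presented state**: term list, exceptional multiplicities, exceptional components. [folklore] -/
structure SData (n : ℕ) (R : Type*) where
  /-- the term list presenting `F` -/
  L : Terms n R
  /-- the exceptional multiplicities `r` -/
  r : Fin n → ℕ
  /-- the exceptional components through the point -/
  exc : Finset (Fin n)

/-- The tree state presented by `s`. [folklore] -/
def SData.toState (s : SData n R) : CState (Fin n) R := ⟨evalT s.L, expo s.r, s.exc⟩

/-- The `F` of the presented state. [folklore] -/
@[simp] theorem SData.toState_F (s : SData n R) : s.toState.F = evalT s.L := rfl

/-- The `r` of the presented state. [folklore] -/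
@[simp] theorem SData.toState_r (s : SData n R) : s.toState.r = expo s.r := rfl

/-- The `exc` of the presented state. [folklore] -/
@[simp] theorem SData.toState_exc (s : SData n R) : s.toState.exc = s.exc := rfl

/-- Least entry of a list of naturals (`0` for the empty list). [folklore] -/
def minNat : List ℕ → ℕ
  | [] => 0
  | [a] => a
  | a :: b :: l => min a (minNat (b :: l))

/-- On a nonempty list `infList` is the coercion of `minNat`. [folklore] -/
theorem infList_cons (a : ℕ) (l : List ℕ) : infList (a :: l) = (minNat (a :: l) : ℕ∞) := by
  induction l generalizing a with
  | nil => simp [infList, minNat]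
  | cons b l ih =>
    rw [infList, ih, minNat]
    rcases le_total a (minNat (b :: l)) with h | h
    · rw [min_eq_left h, min_eq_left (by exact_mod_cast h)]
    · rw [min_eq_right h, min_eq_right (by exact_mod_cast h)]

/-- `toNat ∘ infList = minNat`. [folklore] -/
theorem toNat_infList (l : List ℕ) : (infList l).toNat = minNat l := by
  cases l with
  | nil => rfl
  | cons a l => rw [infList_cons, ENat.toNat_coe]

section Dec

variable [DecidableEq R]

/-- `(ordAlong S F).toNat` on term lists. [folklore] -/
def ordAlongN (S : Finset (Fin n)) (L : Terms n R) : ℕ := minNat ((live L).map fun e => ∑ i ∈ S, e i)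

/-- Transfer of `(ordAlong S F).toNat`. [folklore] -/
theorem toNat_ordAlong_evalT (S : Finset (Fin n)) (L : Terms n R) :
    (ordAlong S (evalT L)).toNat = ordAlongN S L := by
  rw [ordAlong_evalT, toNat_infList]; rfl

/-- **The step on presented states** (chart transform, translation, cleaning, new multiplicities and
components — the tree's `CentreBlowup.step`, field by field). [folklore] -/
def stepD (q : ℕ) (S : Finset (Fin n)) (j : Fin n) (b : Fin n → R) (s : SData n R) : SData n R where
  L := cleanL q (transAll b (chartL q S j s.L))
  r := Function.update (fun i => if b i = 0 then s.r i else 0) j (ordAlongN S s.L - q)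
  exc := insert j (s.exc.filter fun i => b i = 0)

/-- Transfer of the point transform. [folklore] -/
theorem pointTransform_toState (q : ℕ) (S : Finset (Fin n)) (j : Fin n) (b : Fin n → R) (s : SData n R) :
    pointTransform q S j b s.toState = evalT (transAll b (chartL q S j s.L)) := by
  rw [pointTransform, SData.toState_F, chartTransform_evalT, translate_evalT]

/-- **Transfer of the step**: the tree's `CentreBlowup.step` of a presented state is presented by `stepD`.
[folklore] -/
theorem step_toState (q : ℕ) (S : Finset (Fin n)) (j : Fin n) (b : Fin n → R) (s : SData n R) :
    CentreBlowup.step q S j b s.toState = (stepD q S j b s).toState := by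
  have hF : deletePthPowers q (pointTransform q S j b s.toState) = evalT (stepD q S j b s).L := by
    rw [pointTransform_toState, deletePthPowers_evalT]; rfl
  have hr : newMult q S j b s.toState = expo (stepD q S j b s).r := by
    ext i
    rw [newMult, SData.toState_r, SData.toState_F, toNat_ordAlong_evalT, Finsupp.update_apply,
      Finsupp.filter_apply, expo_apply, expo_apply]
    simp only [stepD, Function.update_apply]
  have he : newExc j b s.toState = (stepD q S j b s).exc := rfl
  unfold CentreBlowup.step
  rw [hF, hr, he]; rfl

/-! ## §8 Boolean checks -/

/-- Equality test of presented states. [folklore] -/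
def SData.equivB (s s' : SData n R) : Bool :=
  StepKit.equivB s.L s'.L && decide (s.r = s'.r) && decide (s.exc = s'.exc)

/-- **Transfer of equality of states.** [folklore] -/
theorem toState_eq_iff (s s' : SData n R) : s.toState = s'.toState ↔ s.equivB s' = true := by
  rw [SData.equivB, Bool.and_eq_true, Bool.and_eq_true, decide_eq_true_eq, decide_eq_true_eq,
    ← evalT_eq_iff_equivB, ← expo_inj (e := s.r)]
  constructor
  · intro h
    have h1 := congrArg CState.F h
    have h2 := congrArg CState.r h
    have h3 := congrArg CState.exc h
    exact ⟨⟨h1, h2⟩, h3⟩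
  · rintro ⟨⟨h1, h2⟩, h3⟩
    cases s; cases s'
    simp only [SData.toState] at h1 h2 h3 ⊢
    rw [h1, h2, h3]

/-- **`step … = …` as a Boolean check.** [folklore] -/
theorem step_eq_iff (q : ℕ) (S : Finset (Fin n)) (j : Fin n) (b : Fin n → R) (s s' : SData n R) :
    CentreBlowup.step q S j b s.toState = s'.toState ↔ (stepD q S j b s).equivB s' = true := by
  rw [step_toState, toState_eq_iff]

/-- **`(step …).F ≠ 0` as a Boolean check.** [folklore] -/
theorem step_F_ne_zero_iff (q : ℕ) (S : Finset (Fin n)) (j : Fin n) (b : Fin n → R) (s : SData n R) :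
    (CentreBlowup.step q S j b s.toState).F ≠ 0 ↔ StepKit.equivB (stepD q S j b s).L [] = false := by
  rw [step_toState, SData.toState_F, Ne, evalT_eq_zero_iff, Bool.not_eq_true]

/-- Equimultiplicity test: every exponent of the point transform that is non-zero and of total degree
`< q` has coefficient `0`. [folklore] -/
def equiB (q : ℕ) (S : Finset (Fin n)) (j : Fin n) (b : Fin n → R) (s : SData n R) : Bool :=
  (transAll b (chartL q S j s.L)).all fun t =>
    decide (t.1 = 0) || decide (q ≤ ∑ i, t.1 i) || decide (coeffAt (transAll b (chartL q S j s.L)) t.1 = 0)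

/-- **`IsEquimultiplePoint` as a Boolean check.** [folklore] -/
theorem isEquimultiplePoint_iff (q : ℕ) (S : Finset (Fin n)) (j : Fin n) (b : Fin n → R) (s : SData n R) :
    IsEquimultiplePoint q S j b s.toState ↔ equiB q S j b s = true := by
  unfold IsEquimultiplePoint
  rw [pointTransform_toState]
  set L₁ := transAll b (chartL q S j s.L)
  simp only [equiB, List.all_eq_true, Bool.or_eq_true, decide_eq_true_eq]
  constructor
  · intro h t ht
    by_cases h0 : t.1 = 0
    · exact Or.inl (Or.inl h0)
    by_cases hq : q ≤ ∑ i, t.1 i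
    · exact Or.inl (Or.inr hq)
    refine Or.inr ?_
    have := h (expo t.1) (mt (expo_eq_zero_iff t.1).mp h0) (by rw [degree_expo]; omega)
    rwa [coeff_expo_evalT] at this
  · intro h d hd0 hdq
    rw [coeff_evalT]
    by_cases hmem : ∃ t ∈ L₁, t.1 = ⇑d
    · obtain ⟨t, ht, hte⟩ := hmem
      rcases h t ht with (h0 | hq) | hc
      · exact absurd (by rw [← expo_coe d, ← hte, h0]; exact (expo_eq_zero_iff _).mpr rfl) hd0
      · rw [hte, ← degree_expo, expo_coe] at hq; omega
      · rwa [hte] at hc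
    · exact coeffAt_eq_zero_of_forall_ne fun t ht hte => hmem ⟨t, ht, hte⟩

/-- The shade of a presented state, on the list: `ord₀ F − |r|` in `ℕ∞`. [folklore] -/
def shadeE (s : SData n R) : ℕ∞ := infList ((live s.L).map fun e => ∑ i, e i) - ((∑ i, s.r i : ℕ) : ℕ∞)

end Dec

/-! ## §9 The class-(4,1) predicates at presented states -/

section Four

variable {K : Type} [Field K] [DecidableEq K]

/-- Transfer of the shade. [folklore] -/
theorem shade_toState (s : SData n K) : s.toState.shade = shadeE s := by
  rw [CState.shade, SData.toState_F, SData.toState_r, ordZero_evalT, degree_expo]; rfl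

/-- Permissibility test (condition (1): `S ≠ ∅` and every live exponent has `S`-degree `≥ q`). [folklore] -/
def permB (q : ℕ) (S : Finset (Fin 4)) (L : Terms 4 K) : Bool :=
  decide S.Nonempty && (live L).all fun e => decide (q ≤ ∑ i ∈ S, e i)

/-- **`IsPermissibleCentre` as a Boolean check.** [folklore] -/
theorem isPermissibleCentre_iff (q : ℕ) (S : Finset (Fin 4)) (L : Terms 4 K) :
    IsPermissibleCentre q S (evalT L) ↔ permB q S L = true := by
  unfold IsPermissibleCentre
  rw [ordAlong_evalT, le_infList_iff]
  simp only [permB, Bool.and_eq_true, decide_eq_true_eq, List.all_eq_true, List.mem_map,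
    forall_exists_index, and_imp, forall_apply_eq_imp_iff₂, Nat.cast_le]

/-- MODE-1h test (permissible, and of least cardinality among the permissible centres). [folklore] -/
def mode1hB (q : ℕ) (S : Finset (Fin 4)) (L : Terms 4 K) : Bool :=
  permB q S L && decide (∀ S' : Finset (Fin 4), permB q S' L = true → S.card ≤ S'.card)

/-- **`IsMode1hCentre` as a Boolean check.** [folklore] -/
theorem isMode1hCentre_iff (q : ℕ) (S : Finset (Fin 4)) (L : Terms 4 K) :
    IsMode1hCentre q S (evalT L) ↔ mode1hB q S L = true := by
  unfold IsMode1hCentre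
  simp only [mode1hB, Bool.and_eq_true, decide_eq_true_eq, isPermissibleCentre_iff]

/-- Condition-(2) test `degIn S r + shade ≤ ordAlong S F`, evaluated in `ℕ∞` on the list. [folklore] -/
def perm2B (S : Finset (Fin 4)) (s : SData 4 K) : Bool :=
  decide (((∑ i ∈ S, s.r i : ℕ) : ℕ∞) + shadeE s ≤ infList ((live s.L).map fun e => ∑ i ∈ S, e i))

/-- **`Perm2` as a Boolean check.** [folklore] -/
theorem perm2_iff (S : Finset (Fin 4)) (s : SData 4 K) : Perm2 S s.toState ↔ perm2B S s = true := by
  unfold Perm2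
  rw [shade_toState, SData.toState_r, SData.toState_F, ordAlong_evalT, degIn_expo, perm2B, decide_eq_true_eq]

/-- **`IsModeM1Centre` as a Boolean statement** (unfolded through the checks above). [folklore] -/
theorem isModeM1Centre_iff (q : ℕ) (S : Finset (Fin 4)) (s : SData 4 K) :
    IsModeM1Centre q S s.toState ↔
      (permB q S s.L = true ∧ perm2B S s = true ∧
        ∀ S' : Finset (Fin 4), permB q S' s.L = true → perm2B S' s = true → S.card ≤ S'.card) := by
  unfold IsModeM1Centre
  simp only [SData.toState_F, isPermissibleCentre_iff, perm2_iff]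

/-- **`RiseD` between presented states** is the `ℕ∞` comparison of the list shades. [folklore] -/
theorem riseD_iff (s s' : SData 4 K) : RiseD s.toState s'.toState ↔ shadeE s < shadeE s' := by
  rw [RiseD, shade_toState, shade_toState]

/-- **`EqualD` between presented states.** [folklore] -/
theorem equalD_iff (s s' : SData 4 K) : EqualD s.toState s'.toState ↔ shadeE s' = shadeE s := by
  rw [EqualD, shade_toState, shade_toState]

/-- **`DropD` between presented states.** [folklore] -/
theorem dropD_iff (s s' : SData 4 K) : DropD s.toState s'.toState ↔ shadeE s' < shadeE s := by
  rw [DropD, shade_toState, shade_toState]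

/-- **Edge certificate**: chart `j ∈ S`, point `b` with `b j = 0`, and the three Boolean checks
(equimultiple point, non-zero cleaned transform, the transform is the claimed state). [folklore] -/
theorem edge_of {q : ℕ} {S : Finset (Fin 4)} (j : Fin 4) (b : Fin 4 → K) {s s' : SData 4 K}
    (hj : j ∈ S) (hb : b j = 0) (h1 : equiB q S j b s = true)
    (h2 : StepKit.equivB (stepD q S j b s).L [] = false) (h3 : (stepD q S j b s).equivB s' = true) :
    Edge q S s.toState s'.toState :=
  ⟨j, b, hj, hb, (isEquimultiplePoint_iff q S j b s).mpr h1, (step_F_ne_zero_iff q S j b s).mpr h2,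
    ((step_eq_iff q S j b s s').mpr h3).symm⟩

/-- **MODE-1h step certificate.** [folklore] -/
theorem step1h_of {q : ℕ} (S : Finset (Fin 4)) (j : Fin 4) (b : Fin 4 → K) {s s' : SData 4 K}
    (hS : mode1hB q S s.L = true) (hj : j ∈ S) (hb : b j = 0) (h1 : equiB q S j b s = true)
    (h2 : StepKit.equivB (stepD q S j b s).L [] = false) (h3 : (stepD q S j b s).equivB s' = true) :
    Step1h q s.toState s'.toState :=
  ⟨S, (isMode1hCentre_iff q S s.L).mpr hS, edge_of j b hj hb h1 h2 h3⟩

/-- **HP-permissible step certificate** (conditions (1) ∧ (2)). [folklore] -/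
theorem stepHP_of {q : ℕ} (S : Finset (Fin 4)) (j : Fin 4) (b : Fin 4 → K) {s s' : SData 4 K}
    (hS : permB q S s.L = true) (hS2 : perm2B S s = true) (hj : j ∈ S) (hb : b j = 0)
    (h1 : equiB q S j b s = true) (h2 : StepKit.equivB (stepD q S j b s).L [] = false)
    (h3 : (stepD q S j b s).equivB s' = true) : StepHP q s.toState s'.toState :=
  ⟨S, (isPermissibleCentre_iff q S s.L).mpr hS, (perm2_iff S s).mpr hS2, edge_of j b hj hb h1 h2 h3⟩

/-- **Rule-step certificate** for a centre rule `R` with `R s.toState = S`. [folklore] -/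
theorem stepRule_of {q : ℕ} (Rl : CentreRule K) {S : Finset (Fin 4)} (j : Fin 4) (b : Fin 4 → K)
    {s s' : SData 4 K} (hR : Rl s.toState = S) (hS : permB q S s.L = true) (hj : j ∈ S) (hb : b j = 0)
    (h1 : equiB q S j b s = true) (h2 : StepKit.equivB (stepD q S j b s).L [] = false)
    (h3 : (stepD q S j b s).equivB s' = true) : StepRule q Rl s.toState s'.toState := by
  refine ⟨?_, ?_⟩
  · rw [hR]; exact (isPermissibleCentre_iff q S s.L).mpr hS
  · rw [hR]; exact edge_of j b hj hb h1 h2 h3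

/-- **`IsMode1h2Centre` as a Boolean statement.** [folklore] -/
theorem isMode1h2Centre_iff (q : ℕ) (S : Finset (Fin 4)) (s : SData 4 K) :
    IsMode1h2Centre q S s.toState ↔
      (permB q S s.L = true ∧
        ((∃ S' : Finset (Fin 4), permB q S' s.L = true ∧ perm2B S' s = true) → perm2B S s = true) ∧
        ∀ S' : Finset (Fin 4), permB q S' s.L = true →
          ((∃ S'' : Finset (Fin 4), permB q S'' s.L = true ∧ perm2B S'' s = true) → perm2B S' s = true) →
            S.card ≤ S'.card) := by
  unfold IsMode1h2Centre
  simp only [SData.toState_F, isPermissibleCentre_iff, perm2_iff]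

/-- **m1 step certificate.** [folklore] -/
theorem stepM1_of {q : ℕ} (S : Finset (Fin 4)) (j : Fin 4) (b : Fin 4 → K) {s s' : SData 4 K}
    (hS : permB q S s.L = true ∧ perm2B S s = true ∧
      ∀ S' : Finset (Fin 4), permB q S' s.L = true → perm2B S' s = true → S.card ≤ S'.card)
    (hj : j ∈ S) (hb : b j = 0) (h1 : equiB q S j b s = true)
    (h2 : StepKit.equivB (stepD q S j b s).L [] = false) (h3 : (stepD q S j b s).equivB s' = true) :
    StepM1 q s.toState s'.toState :=
  ⟨S, (isModeM1Centre_iff q S s).mpr hS, edge_of j b hj hb h1 h2 h3⟩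

/-- **1h2 step certificate.** [folklore] -/
theorem step1h2_of {q : ℕ} (S : Finset (Fin 4)) (j : Fin 4) (b : Fin 4 → K) {s s' : SData 4 K}
    (hS : permB q S s.L = true ∧
        ((∃ S' : Finset (Fin 4), permB q S' s.L = true ∧ perm2B S' s = true) → perm2B S s = true) ∧
        ∀ S' : Finset (Fin 4), permB q S' s.L = true →
          ((∃ S'' : Finset (Fin 4), permB q S'' s.L = true ∧ perm2B S'' s = true) → perm2B S' s = true) →
            S.card ≤ S'.card)
    (hj : j ∈ S) (hb : b j = 0) (h1 : equiB q S j b s = true)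
    (h2 : StepKit.equivB (stepD q S j b s).L [] = false) (h3 : (stepD q S j b s).equivB s' = true) :
    Step1h2 q s.toState s'.toState :=
  ⟨S, (isMode1h2Centre_iff q S s).mpr hS, edge_of j b hj hb h1 h2 h3⟩

/-- **MODE-2 step certificate** (any Hironaka-permissible coordinate centre). [folklore] -/
theorem step2_of {q : ℕ} (S : Finset (Fin 4)) (j : Fin 4) (b : Fin 4 → K) {s s' : SData 4 K}
    (hS : permB q S s.L = true) (hj : j ∈ S) (hb : b j = 0) (h1 : equiB q S j b s = true)
    (h2 : StepKit.equivB (stepD q S j b s).L [] = false) (h3 : (stepD q S j b s).equivB s' = true) :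
    Step2 q s.toState s'.toState :=
  ⟨S, (isPermissibleCentre_iff q S s.L).mpr hS, edge_of j b hj hb h1 h2 h3⟩

/-- **MODE-0 (point) step certificate.** [folklore] -/
theorem step0_of {q : ℕ} (j : Fin 4) (b : Fin 4 → K) {s s' : SData 4 K}
    (hS : permB q Finset.univ s.L = true) (hb : b j = 0) (h1 : equiB q Finset.univ j b s = true)
    (h2 : StepKit.equivB (stepD q Finset.univ j b s).L [] = false)
    (h3 : (stepD q Finset.univ j b s).equivB s' = true) : Step0 q s.toState s'.toState :=
  ⟨((isPermissibleCentre_iff q Finset.univ s.L).mpr hS).2, edge_of j b (Finset.mem_univ j) hb h1 h2 h3⟩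

/-- **Spine edge certificate** (chart origin `b = 0`). [folklore] -/
theorem spineEdge_of {q : ℕ} {S : Finset (Fin 4)} (j : Fin 4) {s s' : SData 4 K} (hj : j ∈ S)
    (h1 : equiB q S j 0 s = true) (h2 : StepKit.equivB (stepD q S j 0 s).L [] = false)
    (h3 : (stepD q S j 0 s).equivB s' = true) : SpineEdge q S s.toState s'.toState :=
  ⟨j, hj, (isEquimultiplePoint_iff q S j 0 s).mpr h1, (step_F_ne_zero_iff q S j 0 s).mpr h2,
    ((step_eq_iff q S j 0 s s').mpr h3).symm⟩

/-- Distinct presented states (Boolean check `false`) present distinct tree states. [folklore] -/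
theorem toState_ne_of (s s' : SData n K) (h : s.equivB s' = false) : s.toState ≠ s'.toState := by
  rw [Ne, toState_eq_iff, h]; exact Bool.false_ne_true

end Four

end StepKit

end Summit.ResolutionOfSingularities.ResolutionOfSingularities.Theorems.PIDim4

end
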